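import Summits.BirchSwinnertonDyer.Rank1Residual.Additive.DisegniLineEndState
import Summits.BirchSwinnertonDyer.Rank1Residual.Additive.BranchPAdicGrossZagierUpperHalf
import Summits.BirchSwinnertonDyer.Rank1Residual.Additive.X3CaseOneMember
import HarnessLib

/-!
# Route `AdditiveBranchIMC` (rung K1), crux `GordTwoRankOne` (item 19358): the rank-one LOWER half on
# EVERY (G-ord, `e = 2`) row from published facts + the kernel `p`-adic Gross–Zagier identity + TWO
# per-pair typed inputs — and the off-Case-1 class form (cell `bsd-addord`, seat `bsd-addord-k1-c3`,
# D-0074 row B2; `--supports stmt-BirchSwinnertonDyer-19358 --as helper`)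

HONEST FRAMING. THEOREMS ONLY: no definition, no named fact minted, no `sorry`, nothing booked, BSD is not
proved by any of this. The crux `GordTwoRankOne` (∀ `E/ℚ` of analytic rank `1`, ∀ odd additive
(G)-ordinary `p` of semistability index `2`: `ord_p #Ш(E)_an ≤ ord_p #Ш(E)`) is OPEN at class level: on a
cyclotomic road it needs (i) the Λ-adic LOWER containment `char_Λ X(E/ℚ_∞) ⊆ (𝓛_p)` on the
`ω^{(p−1)/2}`-branch (not in print at any additive pair off the Greenberg–Vatsal Case-1 rows: crux
`GordTwoRankZeroOffCaseOne`'s Λ-adic layer, rank-free; Burungale–Skinner–Tian–Wan 2024 Thm. 9.21(c) is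
PRE) and (ii) `p`-adic height non-degeneracy (Schneider 1982; rider I1 of the cell, MATH-BOUND). This file
does NOT remove either. It proves, in the tree's currency:

* §1 `exists_datum_identity_of_facts` — on every (G-ord) additive row (`Addv`, `TypeGOrd`), `p ≡ 1 (mod 4)`,
  `E` non-CM, `r_an(E) = 1`, at ANY good-ordinary twist model `C • V^{(p)} = W` with newform `f` and period
  ratio `ϖ`: a height datum `Dh` with Delbourgo 2002 Thm. (B) in BOTH currencies and the identity
  `∃ u ∈ ℤ_p^×, q ∈ ℚ: L′(E,1) = q·Ω_E·Reg_∞ ∧ ϖ·[T¹]L_p(f, α, ω^{(p−1)/2})·log_p γ = u·q·Reg_p(E,Dh)` —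
  from PUBLISHED named facts only (`hCyc` = lit's conjoined fact (B) `Disegni2017.delbourgoDatum_cycLineGrossZagier`,
  `hArt`, `h73`, `hWald`, modularity, GZK) through the gz seat's kernel theorems STEP A–C
  (`branchPAdicGrossZagier_identity_of_cycLine`, p412307): gz's C(3c) chain, its X3 hypothesis being idle.
* §2 `cellGordTwo_missingLowerBoundAt_rankOne_of_facts_of_chiBranchLower_of_branchCoeffOneNeZero` — on
  EVERY `N10.CellGordTwo` row (reducible or not, Case-1 member or not, anomalous or not), `p ≡ 1 (mod 4)`,
  non-CM, `r_an = 1`: `MissingLowerBoundAt W p` from the published facts above + Mazur 1972 Cor. 5.15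
  (`hMaz`) + Delbourgo 2002 (A) (`hDel`) + the TWO per-pair typed inputs `ChiBranchLowerDivisibilityAt W p`
  (Λ-adic lower containment on the branch — NOT in print) and `BranchCoeffOneNeZeroAt W p` (`A′ ≠ 0`).
* §3 the OFF-CASE-1 CLASS FORM of the seat fragment (planner D0074 row B2):
  `gordTwoRankOne_offCaseOne_even_of_facts_of_chiBranchLower_of_branchCoeffOneNeZero` — the Λ-adic input
  DISPLAYED class-wide on the slice `N10.CellGordTwo ∧ ¬HasCaseOneMember ∧ p ≡ 1 (mod 4)` (= the Λ-adic,
  rank-free layer of crux `GordTwoRankZeroOffCaseOne`; NOT in print), the certificate per pair.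
* §4 the "O7 twin" on the kernel road: `classX4Gord_bsdp_rankOne_of_BSTW921c_OPEN_of_cycLineFact_of_katoHalf`
  — X4♯(G-ord) ∩ `I₀*` ∩ {`ρ̄` onto} ∩ (ram), `p ≡ 1 (mod 4)`, non-CM, `r_an = 1`, anomalous or not:
  `BSD(E,p)` from the OPEN/PRE BSTW twist clause read Λ-adically (`hΛ`, NEVER a theorem) + the published
  facts + Kato's half (`hK`) + `A′ ≠ 0` — p403164 §3 with `hFact` REPLACED by published facts, `hna` REMOVED.

NOT claimed: the Λ-adic lower containment anywhere (`hdiv` / `hΛ`); Schneider class-wide; anything at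
`p ≡ 3 (mod 4)` (odd branch: gz's `…Odd` identity, in flight), `p = 3`, (M), defect `3,4,6`, CM; no booking.

References: [Disegni2017] Thm. A, B; [Delbourgo2002] Thm. (A), (B), p. 67 (iv), p. 69; [Mazur1972Towers]
Cor. 5.15; [GrossZagier1986] I.(7.3); [Kato2004Asterisque] Thm. 17.4 (3); [Pal2012] Thm. 3.2;
[MazurTateTeitelbaum1986Invent] §I.13–14; [BurungaleSkinnerTianWan2024] Thm. 9.21(c) (PRE; hypothesis only);
[Miller2011LMS] Def. 1.1; cell TARGET.md E39, planner/D0074-bsd-addord-seats.md row B2, PROOF-gz-kernel.md.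
-/

set_option autoImplicit false
set_option linter.dupNamespace false

noncomputable section

open scoped Classical MatrixGroups ModularForm NumberField

open CongruenceSubgroup WeierstrassCurve NumberField IsDedekindDomain Field
  Literature.NumberTheory.EllipticCurves Literature.NumberTheory.EllipticCurves.ModularForms
  Literature.NumberTheory.EllipticCurves.GreenbergVatsal2000
  Literature.NumberTheory.EllipticCurves.Rank1Residual
  Literature.NumberTheory.EllipticCurves.Rank1Residual.Typed
  Literature.NumberTheory.EllipticCurves.Delbourgo2002
  Literature.NumberTheory.EllipticCurves.Disegni2017
  Literature.NumberTheory.GaloisRepresentations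
  Summit.BirchSwinnertonDyer.Rank1Residual.AdditivePotMult
  Summit.BirchSwinnertonDyer.Rank1Residual.Additive

namespace Summit.BirchSwinnertonDyer.BirchSwinnertonDyer.Theorems.AdditiveBranchIMCGordTwoRankOne

variable {W : WeierstrassCurve ℚ} [W.IsElliptic] [W.IsGloballyMinimal] {p : ℕ} [hp : Fact p.Prime]

/-! ### §1 The datum and the identity at a given good twist model, from PUBLISHED facts -/

/-- **The twisted-branch `p`-adic Gross–Zagier identity at a given triple, from published facts.** For `W`
globally minimal without CM, ADDITIVE and (G)-ordinary at `p ≡ 1 (mod 4)`, `r_an(W) = 1`, and ANY good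
ordinary twist model `C • V^{(p)} = W` with newform `f` of `V` and `ϖ·Ω_V = Ω⁺_f`: there is a `p`-adic
height datum `Dh` on `E(ℚ)` carrying Delbourgo 2002 Thm. (B) in both currencies
(`LeadingTermClausesIntrinsic`, `LeadingTermClauses`) and `u ∈ ℤ_p^×`, `q ∈ ℚ` with
`L′(E,1) = q·Ω_E·Reg_∞(E)` and `ϖ·[T¹]L_p(f, α_V, ω^{(p−1)/2})·log_p γ = u·q·Reg_p(E,Dh)`. Inputs (PUBLISHED,
by name): lit's conjoined fact (B) `hCyc` (Disegni 2017 Thm. A/B at `𝟙_K` + Delbourgo 2002 (B)), Artin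
formalism `hArt`, Gross–Zagier I.(7.3) `h73`, Waldspurger's Heegner field with `L(E^{(d_K)},1) ≠ 0` (`hWald`),
modularity, GZK; Pal 2012 Thm. 3.2 is a tree theorem. Chain = the gz seat's STEP C(3c) verbatim (Heegner `K`,
Kronecker character, twist newform, `hCyc.exists_datum_intrinsic`, `branchPAdicGrossZagier_identity_of_cycLine`),
with no hypothesis on the residual image.
[cite: Disegni2017, Theorem A (arXiv v3 PDF pp. 7–8), Theorem B (PDF p. 9), (1.1.3) (PDF pp. 4–5)]
[cite: Delbourgo2002, Theorem (B) (p. 40), p. 67 (iv), p. 69] [cite: GrossZagier1986, Thm. I.(7.3)]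
[cite: Darmon2004, §3.9, proof of Thm. 3.22] [cite: Pal2012, Thm. 3.2] [cite: MazurTateTeitelbaum1986Invent, §I.14] -/
theorem exists_datum_identity_of_facts
    (hCyc : delbourgoDatum_cycLineGrossZagier)
    (hArt : rankinSelbergEulerProductHecke_baseChangeDirichlet_eq) (h73 : GrossZagier1986_thm_I_7_3)
    (hWald : waldspurger_exists_heegnerField_twist_ne_zero)
    (hmod : hasEntireLFunction_rat) (hmodD : nonempty_modularParametrizationData)
    (hmodN : exists_isNewformOf) (hGZK : rank_eq_analyticRank_of_analyticRank_le_one)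
    (haddv : Addv W p) (hG : TypeGOrd W p) (hp4 : p % 4 = 1) (hcm : ¬ W.HasCM)
    (hr : W.analyticRank = 1)
    (V : WeierstrassCurve ℚ) [V.IsElliptic] [V.IsGloballyMinimal] (C : VariableChange ℚ)
    (hV : GoodOrd V p) (hC : C • V.quadraticTwist ((-1 : ℚ) ^ (p / 2) * p) = W)
    {N : ℕ} [NeZero N] {f : CuspForm (Gamma0 N) 2} (hf : IsNewformOf V f)
    (ϖ : ℚ) (hϖ : (ϖ : ℝ) * V.realPeriodRat = plusPeriod f) :
    ∃ Dh : PAdicHeightData W p, LeadingTermClausesIntrinsic W p Dh ∧ LeadingTermClauses W p Dh ∧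
      ∃ (u : ℤ_[p]ˣ) (q : ℚ),
        W.leadingLCoeff = (q : ℂ) * (W.realPeriodRat : ℂ) * (W.regulator : ℂ) ∧
        (ϖ : ℚ_[p]) *
            PowerSeries.coeff 1 (padicLFunctionBranch f ((unitRoot V p : ℤ_[p]) : ℚ_[p]) (p / 2)) *
            padicLog p (cyclotomicGenerator p) =
          ((u : ℤ_[p]) : ℚ_[p]) * (q : ℚ_[p]) * padicRegulator Dh := by
  -- adapted from gz's `ClassX3Gord.bsdp_rankOne_of_facts_of_cycLineFact_intrinsic_of_branchCoeffOneNeZero`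
  have hpP : p.Prime := hp.out
  have hp5 : 5 ≤ p := by have := hpP.two_le; omega
  have hps : ((-1 : ℚ) ^ (p / 2) * (p : ℚ)) = (p : ℚ) := by
    rw [(show Even (p / 2) from ⟨p / 4, by omega⟩).neg_one_pow, one_mul]
  have hVW : ∃ C : VariableChange ℚ, C • V.quadraticTwist (p : ℚ) = W := ⟨C, by rw [← hps]; exact hC⟩
  have hordin : IsOrdinaryAt V p := ⟨hV.1, hV.2⟩
  haveI : NeZero (W.conductorNorm ℤ) := ⟨(W.conductorNorm_pos_holds).ne'⟩
  obtain ⟨DmW⟩ := hmodD W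
  -- the Heegner field with `L(E^{(d_K)}, 1) ≠ 0` (Waldspurger)
  have hroot : W.rootNumber = -1 := by
    rcases rootNumber_eq_one_or_eq_neg_one W with h1 | h1
    · exfalso
      have hev1 : Even W.analyticRank :=
        (even_analyticRank_iff_rootNumber_eq_one_of_exists_isNewformOf W hmodN).mpr h1
      rw [hr] at hev1
      exact Nat.not_even_one hev1
    · exact h1
  obtain ⟨K, _, _, hK, -, hHeeg, hLd⟩ := hWald W hroot 0
  have h2 : Module.finrank ℚ K = 2 := hK.1
  haveI : IsGalois ℚ K := isGalois_of_finrank_eq_two K h2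
  have hdq : (NumberField.discr K : ℚ) ≠ 0 := by exact_mod_cast NumberField.discr_ne_zero K
  -- the Kronecker character and the twist data
  obtain ⟨κ, hκ, hκ2, hκall⟩ := exists_kroneckerChar_twistCoeff K h2
  obtain ⟨hpd, hκW, V', iV', iVm', N', _, f', hfV', hV', hap, hordV'⟩ :=
    exists_twist_newform K hmodD hmodN hp4 h2 κ hκ hκall hHeeg haddv V hVW hV hf
  have hpdN : Nat.Coprime p (NumberField.discr K).natAbs :=
    (Nat.Prime.coprime_iff_not_dvd hpP).mpr fun h ↦ hpd (Int.natCast_dvd.mpr h)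
  have hS' : legendrePlusSymbolSum f' p ≠ 0 :=
    legendrePlusSymbolSum_ne_zero_of_twist K hmod hp4 κ hκW haddv V hVW hf hfV'.1
      hfV'.coeffField_eq_bot hV' hLd
  have hrd : (W.quadraticTwist (NumberField.discr K : ℚ)).mordellWeilRank = 0 := by
    haveI := W.isElliptic_quadraticTwist hdq
    have h0 : (W.quadraticTwist (NumberField.discr K : ℚ)).analyticRank = 0 :=
      (analyticRank_eq_zero_iff_holds (hmod _)).mpr hLd
    rw [(hGZK _ (by rw [h0]; exact zero_le_one)).1, h0]
  -- the datum, in both currencies: lit's conjoined fact (B)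
  obtain ⟨ι⟩ := PadicAlgCl.nonempty_ringEquiv_complex (p := p)
  have hpstar : ((pStar p : ℤ) : ℚ) = (-1 : ℚ) ^ (p / 2) * p := by
    rw [pStar, show (p - 1) / 2 = p / 2 by omega]
    push_cast
    ring
  have hCps : C • V.quadraticTwist (pStar p : ℚ) = W := by rw [hpstar]; exact hC
  obtain ⟨Dh, DhK, hres, hBι, hB, hGZc⟩ := hCyc.exists_datum_intrinsic ι hp5 hcm haddv hG hr hCps
    (Or.inl ⟨hV.1, hordin, rfl⟩) DmW.isNewformOf hK hHeeg
  -- STEP C(2): the identity at `(V, f, ϖ)`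
  obtain ⟨u, q, hlead, hpgz⟩ := branchPAdicGrossZagier_identity_of_cycLine ι K hp4 hArt h73
    Pal2012.thm32_sqrt_mul_realPeriodRat_twist_eq_of_prime_one_mod_four_holds hmod hGZK h2 κ hκ hκ2
    hpdN hrd haddv hr V V' hVW hV hordV' hap hf DmW.isNewformOf hfV' hV' hS' ϖ hϖ hres hGZc
  exact ⟨Dh, hBι, hB, u, q, hlead, hpgz⟩

/-! ### §2 EVERY (G-ord, `e = 2`) row: the rank-one LOWER half from the two per-pair typed inputs -/

/-- **The lower half at a given good twist model, from the identity** (bookkeeping core of §2/§4): on an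
additive (G)-ordinary row, `p ≡ 1 (mod 4)`, non-CM, `r_an = 1`, given a good ordinary twist model
`C • V^{(p)} = W` with newform `f` and `ϖ·Ω_V = Ω⁺_f`, a datum `Dh` with Delbourgo's (B♮) clauses and the
identity of §1 at `(V, f, ϖ)`, the Λ-adic input `ChiBranchLowerDivisibilityAt W p` and the certificate
`BranchCoeffOneNeZeroAt W p` give `MissingLowerBoundAt W p`: Schneider for `Dh`
(`schneiderConjecture_of_identity_of_branchCoeffOneNeZero`), the rank-one lower factorisation
(`cycLowerBoundAt_of_chiBranchLower_of_identity`), Delbourgo 2002 (A) (`hDel`), and the unit factors at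
`𝔭 ∣ p` from Mazur 1972 Cor. 5.15 (`hMaz`) via `UniversalNormTwist.not_dvd_localUniversalNormIndex_of_goodOrd_twist`
into `missingLowerBoundAt_of_cycLowerBound_of_not_dvd_index`. [cite: Delbourgo2002, Theorem (A), (B) (p. 40), p. 67 (iv), p. 69]
[cite: Mazur1972Towers, Cor. 5.15 with Remark (p. 229)] [cite: Pal2012, Thm. 3.2] [cite: Miller2011LMS, Def. 1.1] -/
theorem missingLowerBoundAt_rankOne_of_model_of_identity_of_chiBranchLower_of_branchCoeffOneNeZero
    (hMaz : Mazur1972.cor515_universalNormIndex) (hDel : Delbourgo2002.mainTheorem)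
    (hmod : hasEntireLFunction_rat) (hGZK : rank_eq_analyticRank_of_analyticRank_le_one)
    (haddv : Addv W p) (hG : TypeGOrd W p) (hp4 : p % 4 = 1) (hcm : ¬ W.HasCM)
    (hr : W.analyticRank = 1)
    (V : WeierstrassCurve ℚ) [V.IsElliptic] [V.IsGloballyMinimal] (C : VariableChange ℚ)
    (hV : GoodOrd V p) (hC : C • V.quadraticTwist ((-1 : ℚ) ^ (p / 2) * p) = W)
    {N : ℕ} [NeZero N] (f : CuspForm (Gamma0 N) 2) (hf : IsNewformOf V f)
    (ϖ : ℚ) (hϖ : (ϖ : ℝ) * V.realPeriodRat = plusPeriod f)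
    {Dh : PAdicHeightData W p} (hBι : LeadingTermClausesIntrinsic W p Dh) {u : ℤ_[p]ˣ} {q : ℚ}
    (hlead : W.leadingLCoeff = (q : ℂ) * (W.realPeriodRat : ℂ) * (W.regulator : ℂ))
    (hpgz : (ϖ : ℚ_[p]) *
        PowerSeries.coeff 1 (padicLFunctionBranch f ((unitRoot V p : ℤ_[p]) : ℚ_[p]) (p / 2)) *
        padicLog p (cyclotomicGenerator p) = ((u : ℤ_[p]) : ℚ_[p]) * (q : ℚ_[p]) * padicRegulator Dh)
    (hdiv : ChiBranchLowerDivisibilityAt W p) (hne : BranchCoeffOneNeZeroAt W p) :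
    MissingLowerBoundAt W p := by
  have hp2 : p ≠ 2 := by omega
  have hp5 : 5 ≤ p := by have := hp.out.two_le; omega
  have hps : ((-1 : ℚ) ^ (p / 2) * (p : ℚ)) = (p : ℚ) := by
    rw [(show Even (p / 2) from ⟨p / 4, by omega⟩).neg_one_pow, one_mul]
  have hVW : ∃ C : VariableChange ℚ, C • V.quadraticTwist (p : ℚ) = W := ⟨C, by rw [← hps]; exact hC⟩
  -- the two unit factors at the place over `p` (Mazur 1972 via the twist transport)
  set v₀ : HeightOneSpectrum (𝓞 ℚ) := (Rat.HeightOneSpectrum.primesEquiv (R := 𝓞 ℚ)).symm ⟨p, hp.out⟩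
    with hv₀_def
  have hv₀ : (p : 𝓞 ℚ) ∈ v₀.asIdeal := natCast_mem_asIdeal_of_primesEquiv_eq (primesEquiv_symm_apply_coe p)
  have hcp0 : W.tamagawaNumberAt v₀ ≠ 0 := (tamagawaNumberAt_ne_zero_and_le_four_of_addv W p haddv).1
  have hι : ∀ κ : ZpExtension ℚ p, κ.IsCyclotomic →
      localUniversalNormIndex (W := W) (v₀.adicCompletion ℚ) κ ⊤ ≠ 0 →
      ¬ p ∣ localUniversalNormIndex (W := W) (v₀.adicCompletion ℚ) κ ⊤ :=
    fun κ hκ h0 ↦ UniversalNormTwist.not_dvd_localUniversalNormIndex_of_goodOrd_twist V W κ v₀ hMaz hp2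
      hV.1 (by exact_mod_cast hV.2) hκ hv₀ hC h0
  -- (S), the lower factorisation, the lower half
  have hSch : SchneiderConjecture Dh :=
    schneiderConjecture_of_identity_of_branchCoeffOneNeZero hp4 hne V C hC ⟨hV.1, hV.2⟩ f hf ϖ hϖ hpgz
  have hlow : CycLowerBoundAt W p Dh :=
    cycLowerBoundAt_of_chiBranchLower_of_identity W p
      Pal2012.thm32_sqrt_mul_realPeriodRat_twist_eq_of_prime_one_mod_four_holds hmod hGZK haddv hr hp4
      V hVW hV hf ϖ hϖ hdiv hlead hpgz
  exact missingLowerBoundAt_of_cycLowerBound_of_not_dvd_index W p hBι hSch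
    (fun κ' γ hκ' hγ D ↦ hDel.isTorsion hp5 hcm haddv hG hκ' hγ D) hGZK (by rw [hr]) v₀ hv₀ hcp0 hι hlow

/-- **Cell (G-ord, `e = 2`) (`N10.CellGordTwo`: odd additive `p`, (G)-ordinary, Kodaira `I₀*`), `p ≡ 1
(mod 4)`, `E` non-CM, `r_an(E) = 1`, ANY residual image, ANOMALOUS OR NOT: the LOWER half
`ord_p #Ш(E)_an ≤ ord_p #Ш(E)` (`Typed.MissingLowerBoundAt W p`) from PUBLISHED named facts + TWO typed
per-pair inputs** — (L) the Λ-adic branch lower containment `ChiBranchLowerDivisibilityAt W p`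
(`char_Λ X(E/ℚ_∞) ⊆ (ϖ·L_p(f_V, α, ω^{(p−1)/2}))`, Skinner–Urban direction on the branch; NOT in print at
any additive pair off the Case-1 rows) and (S′) the analytic certificate `BranchCoeffOneNeZeroAt W p`
(`[T¹](ϖ·L_p) ≠ 0`, i.e. `A′ ≠ 0`; = Schneider for the datum, by the identity). Published binders:
Mazur 1972 Cor. 5.15 (`hMaz`), lit's fact (B) `hCyc`, `hArt`, `h73`, `hWald`, Delbourgo 2002 (A) (`hDel`),
modularity, GZK. Chain: twist model (`TypeGOrd.exists_goodOrd_pStar_twist_model`); §1; the core above. On the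
Case-1 rows `hdiv` is the twist seat's `X3Branch.chiBranchLowerDivisibilityAt_of_facts`, elsewhere it is
crux `GordTwoRankZeroOffCaseOne`'s Λ-adic layer. Nothing booked.
[cite: Delbourgo2002, Theorem (A), (B) (p. 40), p. 67 (iv), p. 69] [cite: Mazur1972Towers, Cor. 5.15]
[cite: Disegni2017, Theorem A/B (arXiv v3 PDF 7–9)] [cite: Pal2012, Thm. 3.2] [cite: Miller2011LMS, Def. 1.1] -/
theorem cellGordTwo_missingLowerBoundAt_rankOne_of_facts_of_chiBranchLower_of_branchCoeffOneNeZero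
    (hMaz : Mazur1972.cor515_universalNormIndex) (hCyc : delbourgoDatum_cycLineGrossZagier)
    (hArt : rankinSelbergEulerProductHecke_baseChangeDirichlet_eq) (h73 : GrossZagier1986_thm_I_7_3)
    (hWald : waldspurger_exists_heegnerField_twist_ne_zero) (hDel : Delbourgo2002.mainTheorem)
    (hmod : hasEntireLFunction_rat) (hmodD : nonempty_modularParametrizationData)
    (hmodN : exists_isNewformOf) (hGZK : rank_eq_analyticRank_of_analyticRank_le_one)
    (hc : N10.CellGordTwo W p) (hp4 : p % 4 = 1) (hcm : ¬ W.HasCM) (hr : W.analyticRank = 1)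
    (hdiv : ChiBranchLowerDivisibilityAt W p) (hne : BranchCoeffOneNeZeroAt W p) :
    MissingLowerBoundAt W p := by
  obtain ⟨hp2, haddv, hG, he⟩ := hc
  -- the twist model, its newform and period ratio
  obtain ⟨V, iV, iVm, C, hV, hC⟩ := TypeGOrd.exists_goodOrd_pStar_twist_model W p hp2 hG haddv he
  haveI : NeZero (V.conductorNorm ℤ) := ⟨(V.conductorNorm_pos_holds).ne'⟩
  obtain ⟨Dm⟩ := hmodD V
  obtain ⟨ϖ, -, hϖ, -⟩ := Dm.exists_rat_mul_realPeriodRat_eq_plusPeriod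
  -- §1: the datum and the identity; then the core
  obtain ⟨Dh, hBι, -, u, q, hlead, hpgz⟩ := exists_datum_identity_of_facts hCyc hArt h73 hWald hmod
    hmodD hmodN hGZK haddv hG hp4 hcm hr V C hV hC Dm.isNewformOf ϖ hϖ
  exact missingLowerBoundAt_rankOne_of_model_of_identity_of_chiBranchLower_of_branchCoeffOneNeZero hMaz
    hDel hmod hGZK haddv hG hp4 hcm hr V C hV hC Dm.f Dm.isNewformOf ϖ hϖ hBι hlead hpgz hdiv hne

/-! ### §3 The OFF-CASE-1 class form (seat fragment D0074 row B2): Λ-adic input displayed class-wide -/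

/-- **Crux `GordTwoRankOne` OFF the Case-1 rows, `p ≡ 1 (mod 4)`, non-CM: the class form MODULO the
displayed Λ-adic input and the per-pair certificate.** GRANTED the Λ-adic branch lower containment on the
slice {cell (G-ord, `e = 2`), NO Case-1 member in the isogeny class, `p ≡ 1 (mod 4)`} (`hΛ` — the
rank-free Λ-adic layer of crux `GordTwoRankZeroOffCaseOne`: Skinner–Urban-type Eisenstein congruences for
`f_V ⊗ ω^{(p−1)/2}` on the irreducible rows, Greenberg's μ-territory on the reducible no-Case-1 rows; NOT
in print, NOT asserted), every such row of analytic rank `1` with `A′ ≠ 0` (`BranchCoeffOneNeZeroAt W p`,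
certified per pair) satisfies `ord_p #Ш(E)_an ≤ ord_p #Ш(E)`. The registered stub `stub_offCaseOne` is this
statement with `hΛ`, `¬CM`, `p ≡ 1 (mod 4)` and the certificate discharged (the certificate = Schneider at
the pair, rider I1, H3: not attacked). [cite: Delbourgo2002, Theorem (A), (B) (p. 40)] [cite: Mazur1972Towers, Cor. 5.15]
[cite: SkinnerUrban2014, Thm. 3.6.4 (p. 43) (shape only; nothing asserted)] [cite: Miller2011LMS, Def. 1.1] -/
theorem gordTwoRankOne_offCaseOne_even_of_facts_of_chiBranchLower_of_branchCoeffOneNeZero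
    (hMaz : Mazur1972.cor515_universalNormIndex) (hCyc : delbourgoDatum_cycLineGrossZagier)
    (hArt : rankinSelbergEulerProductHecke_baseChangeDirichlet_eq) (h73 : GrossZagier1986_thm_I_7_3)
    (hWald : waldspurger_exists_heegnerField_twist_ne_zero) (hDel : Delbourgo2002.mainTheorem)
    (hmod : hasEntireLFunction_rat) (hmodD : nonempty_modularParametrizationData)
    (hmodN : exists_isNewformOf) (hGZK : rank_eq_analyticRank_of_analyticRank_le_one)
    (hΛ : ∀ (W : WeierstrassCurve ℚ) [W.IsElliptic] [W.IsGloballyMinimal] (p : ℕ) [Fact p.Prime],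
      N10.CellGordTwo W p → ¬ HasCaseOneMember W p → p % 4 = 1 → ChiBranchLowerDivisibilityAt W p) :
    ∀ (W : WeierstrassCurve ℚ) [W.IsElliptic] [W.IsGloballyMinimal] (p : ℕ) [Fact p.Prime],
      W.analyticRank = 1 → N10.CellGordTwo W p → ¬ HasCaseOneMember W p →
      p % 4 = 1 → ¬ W.HasCM → BranchCoeffOneNeZeroAt W p → MissingLowerBoundAt W p :=
  fun W _ _ p _ hr hc hm hp4 hcm hne ↦
    cellGordTwo_missingLowerBoundAt_rankOne_of_facts_of_chiBranchLower_of_branchCoeffOneNeZero hMaz hCyc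
      hArt h73 hWald hDel hmod hmodD hmodN hGZK hc hp4 hcm hr (hΛ W p hc hm hp4) hne

/-! ### §4 X4♯(G-ord) ∩ `I₀*`, `p ≡ 1 (mod 4)`: the "O7 twin" on the kernel road (BSTW clause displayed) -/

/-- **X4♯(G-ord) ∩ `I₀*` (`E[p]` irreducible, `e = 2`) ∩ (ram), `p ≡ 1 (mod 4)`, non-CM, `r_an = 1`, ANY
image size, anomalous or not: the LOWER half `MissingLowerBoundAt W p` GRANTED the OPEN/PRE
Burungale–Skinner–Tian–Wan twist clause read Λ-adically (`hΛ`, NEVER a theorem), from the published facts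
+ `A′ ≠ 0`** — §2 with `hdiv := hΛ` on its slice. No surjectivity needed for the lower half.
[claim: BurungaleSkinnerTianWan2024, status: under-review] [cite: Delbourgo2002, Theorem (A), (B) (p. 40)]
[cite: Mazur1972Towers, Cor. 5.15] [cite: Miller2011LMS, Def. 1.1] -/
theorem classX4Gord_missingLowerBoundAt_rankOne_of_BSTW921c_OPEN_of_facts_of_branchCoeffOneNeZero
    (hΛ : BurungaleSkinnerTianWan2024_thm921c_twist_chiBranchLowerDivisibility_OPEN)
    (hMaz : Mazur1972.cor515_universalNormIndex) (hCyc : delbourgoDatum_cycLineGrossZagier)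
    (hArt : rankinSelbergEulerProductHecke_baseChangeDirichlet_eq) (h73 : GrossZagier1986_thm_I_7_3)
    (hWald : waldspurger_exists_heegnerField_twist_ne_zero) (hDel : Delbourgo2002.mainTheorem)
    (hmod : hasEntireLFunction_rat) (hmodD : nonempty_modularParametrizationData)
    (hmodN : exists_isNewformOf) (hGZK : rank_eq_analyticRank_of_analyticRank_le_one)
    (hX : ClassX4Gord W p) (he : semistabilityIndex W p = 2) (hp4 : p % 4 = 1) (hcm : ¬ W.HasCM)
    (hram : Ram W p) (hr : W.analyticRank = 1) (hne : BranchCoeffOneNeZeroAt W p) :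
    MissingLowerBoundAt W p := by
  have hp5 : 5 ≤ p := by have := hp.out.two_le; omega
  have hc : N10.CellGordTwo W p := ⟨hX.addv.1, hX.addv.2, hX.typeGOrd, he⟩
  exact cellGordTwo_missingLowerBoundAt_rankOne_of_facts_of_chiBranchLower_of_branchCoeffOneNeZero hMaz
    hCyc hArt h73 hWald hDel hmod hmodD hmodN hGZK hc hp4 hcm hr (hΛ W p hp5 hp4 hc hX.1.2.2 hram) hne

omit [W.IsGloballyMinimal] in
/-- **X4♯(G-ord) ∩ `I₀*` ∩ {`ρ̄_{E,p}` onto}, `p ≡ 1 (mod 4)`, `r_an = 1`: the UPPER half from ONE identity +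
the rider + Kato's half** — copy of
`ClassX4Gord.missingUpperBoundAt_rankOne_of_katoHalf_of_schneider_of_branchPAdicGrossZagier`
(BranchPAdicGrossZagierUpperHalf) keyed to a given `(V, C, f, ϖ)` and the identity there (X4 twin of gz's
`ClassX3Gord.missingUpperBoundAt_rankOne_of_wuthrichHalf_of_identity`); Kato's half `hK`, tower from surj(`p`).
[cite: Kato2004Asterisque, Thm. 17.4 (3) (p. 273)] [cite: Wuthrich2014, Lemma 20 (p. 399)]
[cite: Delbourgo2002, Theorem (B) (p. 40)] [cite: Miller2011LMS, Def. 1.1] -/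
theorem classX4Gord_missingUpperBoundAt_rankOne_of_katoHalf_of_identity [W.IsGloballyMinimal]
    (hK : Wuthrich2014.kato_halfEigenCharIdeal_dvd_cyclotomicPrime_of_surjective)
    (hGZK : rank_eq_analyticRank_of_analyticRank_le_one) (hmod : hasEntireLFunction_rat)
    (hX : ClassX4Gord W p) (hp4 : p % 4 = 1) (hsurj : Surj W p) (hr : W.analyticRank = 1)
    {Dh : PAdicHeightData W p} (hB : LeadingTermClauses W p Dh) (hS : SchneiderConjecture Dh)
    (V : WeierstrassCurve ℚ) [V.IsElliptic] [V.IsGloballyMinimal] (hV : GoodOrd V p)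
    (C : VariableChange ℚ) (hC : C • V.quadraticTwist ((-1 : ℚ) ^ (p / 2) * p) = W)
    {N : ℕ} [NeZero N] {f : CuspForm (Gamma0 N) 2} (hf : IsNewformOf V f)
    (ϖ : ℚ) (hϖ : (ϖ : ℝ) * V.realPeriodRat = plusPeriod f) {u' : ℤ_[p]ˣ} {q : ℚ}
    (hlead : W.leadingLCoeff = (q : ℂ) * (W.realPeriodRat : ℂ) * (W.regulator : ℂ))
    (hpgz : (ϖ : ℚ_[p]) *
        PowerSeries.coeff 1 (padicLFunctionBranch f ((unitRoot V p : ℤ_[p]) : ℚ_[p]) (p / 2)) *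
        padicLog p (cyclotomicGenerator p) = ((u' : ℤ_[p]) : ℚ_[p]) * (q : ℚ_[p]) * padicRegulator Dh) :
    MissingUpperBoundAt W p := by
  -- adapted from `ClassX4Gord.missingUpperBoundAt_rankOne_of_katoHalf_of_schneider_of_branchPAdicGrossZagier`
  have hp2 : p ≠ 2 := hX.addv.1
  have heven : Even (p / 2) := ⟨p / 4, by omega⟩
  have hmw : W.mordellWeilRank = 1 := by rw [(hGZK W (by rw [hr])).1, hr]
  obtain ⟨κ, γ, hκ, hγ, hγ', D, fE, hchar⟩ := exists_cyclotomic_dualData_generator W p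
  haveI : Module.Finite (IwasawaAlgebra p) D.X :=
    SelmerDualData.module_finite_of_isCyclotomic (W := W) (κ := κ) hκ D hγ
  have hj := padicValRat_j_nonneg_of_typeGOrd W p hX.typeGOrd
  have hsV : Surj V p := (surj_iff_of_model_twist V p (pStar_ne_zero p) ⟨C, hC⟩).mp hsurj
  have hsurjV : ∀ n : ℕ, V.HasSurjectiveModNGaloisRep (p ^ n : ℕ) :=
    V.forall_hasSurjectiveModNGaloisRep_pow_of_goodOrdinary_of_surj p hp2 hV.1 hV.2 hsV
  have hϖ' : (if Even (p / 2) then (ϖ : ℝ) * V.realPeriodRat = plusPeriod f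
      else (ϖ : ℝ) * V.imaginaryPeriodRat = minusPeriod f) := by
    rw [if_pos heven]; exact hϖ
  obtain ⟨hXt, g, hg, u, hι⟩ := isTorsion_and_exists_iota_eq_branch_of_katoComponent W p
    (Kato2004.charIdeal_dvd_padicLFunctionBranch_component_of_surjective_of_half hK) hj hp2 V
    ⟨C, hC⟩ (Or.inl hV) hsurjV hκ hγ hγ' hf D ϖ hϖ'
  rw [if_pos heven] at hι
  have hpgz' : ((ϖ : ℚ) : ℚ_[p]) * PowerSeries.coeff W.mordellWeilRank
        (padicLFunctionBranch f ((unitRoot V p : ℤ_[p]) : ℚ_[p]) (p / 2)) *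
        padicLog p (cyclotomicGenerator p) ^ W.mordellWeilRank =
      ((u' : ℤ_[p]) : ℚ_[p]) * (q : ℚ_[p]) * padicRegulator Dh := by
    rw [hmw, pow_one]
    exact hpgz
  exact missingUpperBoundAt_rankOne_of_iota_eq_of_pgz hp2 hGZK hmod hr hB hS hκ hγ hγ' D hXt hchar hg
    hι hlead hpgz'

/-- **THE "O7 TWIN" ON THE KERNEL ROAD.** X4♯(G-ord) ∩ `I₀*` (`e = 2`) ∩ {`ρ̄_{E,p}` onto} ∩ (ram),
`p ≡ 1 (mod 4)` (so `p ≥ 5`), `E` non-CM, `r_an(E) = 1`, ANOMALOUS OR NOT: `BSD(E,p)` GRANTED the OPEN/PRE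
Burungale–Skinner–Tian–Wan twist clause read Λ-adically on the `χ_p`-branch (`hΛ` — NOT a theorem), from
PUBLISHED named facts (Mazur 1972 Cor. 5.15 `hMaz`; lit's conjoined fact (B) `hCyc`; `hArt`; `h73`;
Waldspurger `hWald`; Delbourgo 2002 (A)+(B) `hDel`; Kato 2004 Thm. 17.4 (3) on the half eigenspace `hK`;
modularity `hmod`/`hmodD`/`hmodN`; GZK `hGZK`) and ONE analytic number `BranchCoeffOneNeZeroAt W p`
(`A′ ≠ 0` = Schneider for the datum). The predecessor
`ClassX4Gord.bsdp_rankOne_of_BSTW921c_OPEN_of_delbourgoDatumFact_of_katoHalf` (p403164 §3) with the cell's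
reading fact `hFact` REPLACED by published facts (through §1 = gz's kernel road) and the non-anomalous
hypothesis `hna` REMOVED (`hMaz`, twist (T3)). Chain: (L) `hΛ` on its slice; twist model; §1; lower = §2
core; upper = `classX4Gord_missingUpperBoundAt_rankOne_of_katoHalf_of_identity`; glue
`missingPPartAt_of_lower_of_upper`, `bsdp_of_missingPPartAt`. Nothing booked.
[claim: BurungaleSkinnerTianWan2024, status: under-review] [cite: Delbourgo2002, Theorem (A), (B) (p. 40), p. 67 (iv), p. 69]
[cite: Mazur1972Towers, Cor. 5.15] [cite: Kato2004Asterisque, Thm. 17.4 (3) (p. 273)]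
[cite: Disegni2017, Theorem A/B (arXiv v3 PDF 7–9)] [cite: Pal2012, Thm. 3.2] [cite: Miller2011LMS, Def. 1.1] -/
theorem classX4Gord_bsdp_rankOne_of_BSTW921c_OPEN_of_cycLineFact_of_katoHalf
    (hΛ : BurungaleSkinnerTianWan2024_thm921c_twist_chiBranchLowerDivisibility_OPEN)
    (hMaz : Mazur1972.cor515_universalNormIndex) (hCyc : delbourgoDatum_cycLineGrossZagier)
    (hArt : rankinSelbergEulerProductHecke_baseChangeDirichlet_eq) (h73 : GrossZagier1986_thm_I_7_3)
    (hWald : waldspurger_exists_heegnerField_twist_ne_zero) (hDel : Delbourgo2002.mainTheorem)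
    (hK : Wuthrich2014.kato_halfEigenCharIdeal_dvd_cyclotomicPrime_of_surjective)
    (hmod : hasEntireLFunction_rat) (hmodD : nonempty_modularParametrizationData)
    (hmodN : exists_isNewformOf) (hGZK : rank_eq_analyticRank_of_analyticRank_le_one)
    (hX : ClassX4Gord W p) (he : semistabilityIndex W p = 2) (hp4 : p % 4 = 1) (hcm : ¬ W.HasCM)
    (hsurj : Surj W p) (hram : Ram W p) (hr : W.analyticRank = 1) (hne : BranchCoeffOneNeZeroAt W p) :
    BSDp W p := by
  have hp2 : p ≠ 2 := hX.addv.1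
  have hp5 : 5 ≤ p := by have := hp.out.two_le; omega
  have hc : N10.CellGordTwo W p := ⟨hp2, hX.addv.2, hX.typeGOrd, he⟩
  -- (L) on BSTW's slice
  have hdiv : ChiBranchLowerDivisibilityAt W p := hΛ W p hp5 hp4 hc hX.1.2.2 hram
  -- the twist model, its newform and period ratio
  obtain ⟨V, iV, iVm, C, hV, hC⟩ := hX.exists_goodOrd_pStar_twist_model W p he
  have hordin : IsOrdinaryAt V p := ⟨hV.1, hV.2⟩
  haveI : NeZero (V.conductorNorm ℤ) := ⟨(V.conductorNorm_pos_holds).ne'⟩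
  obtain ⟨Dm⟩ := hmodD V
  obtain ⟨ϖ, -, hϖ, -⟩ := Dm.exists_rat_mul_realPeriodRat_eq_plusPeriod
  -- §1: the datum and the identity
  obtain ⟨Dh, hBι, hB, u, q, hlead, hpgz⟩ := exists_datum_identity_of_facts hCyc hArt h73 hWald hmod
    hmodD hmodN hGZK hX.addv.2 hX.typeGOrd hp4 hcm hr V C hV hC Dm.isNewformOf ϖ hϖ
  -- lower half (§2 core), Schneider, upper half, glue
  have hl : MissingLowerBoundAt W p :=
    missingLowerBoundAt_rankOne_of_model_of_identity_of_chiBranchLower_of_branchCoeffOneNeZero hMaz hDel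
      hmod hGZK hX.addv.2 hX.typeGOrd hp4 hcm hr V C hV hC Dm.f Dm.isNewformOf ϖ hϖ hBι hlead hpgz hdiv hne
  have hSch : SchneiderConjecture Dh :=
    schneiderConjecture_of_identity_of_branchCoeffOneNeZero hp4 hne V C hC hordin Dm.f Dm.isNewformOf ϖ
      hϖ hpgz
  have hu : MissingUpperBoundAt W p :=
    classX4Gord_missingUpperBoundAt_rankOne_of_katoHalf_of_identity hK hGZK hmod hX hp4 hsurj hr hB hSch
      V hV C hC Dm.isNewformOf ϖ hϖ hlead hpgz
  exact bsdp_of_missingPPartAt W p hGZK (by rw [hr]) (missingPPartAt_of_lower_of_upper W p hl hu)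

end Summit.BirchSwinnertonDyer.BirchSwinnertonDyer.Theorems.AdditiveBranchIMCGordTwoRankOne

end
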